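import Literature.Probability.Percolation.ArmSeparationSepInitFour
import Literature.Probability.Percolation.ArmSeparationExtFourAdj
import HarnessLib

/-!
# The initial estimate of the four-arm separation scheme for the ADJACENT arrangement, at `p`

Topic `Literature/Probability/Percolation`; family `crit-perc` / near-critical percolation on `𝕋`.
A brick of the near-critical arm-separation theorem for four arms in the adjacent colour
arrangement (P. Nolin, *Near-critical percolation in two dimensions*, EJP 13 (2008), Thm. 11 for
`j = 4`, `σ = BBWW` [arXiv 0711.4948: Thm. 10]; §4.3 Prop. 14, §4.4 first scale), the last
missing input of the tree's proof of Werner's Lemma 6.3 for the order-free `π̂_t`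
(`Werner2009_lemma63_of_altSeparation_of_adjSeparation`). The adjacent twin of
`ArmSeparationSepInitFour.lean`: at bounded ratio the four well-separated adjacent arms with
landing areas on the sides `0, 2` (open), `3, 5` (closed) (`sepFourAdjQ m N`,
`ArmSeparationExtFourAdj.lean`) have probability bounded below,
`P_p(sepFourAdjQ m N) ≥ (c⁵)⁴` for `1100 ≤ m`, `2m ≤ N ≤ 10 m`, at a general parameter `p` with
Russo–Seymour–Welsh inputs at `p` and `1 - p`: the explicit fenced open arm `sepInitArm m N`
(`ArmSeparationSepInit.lean`) read in the frames `0, 2` for `ω` and `3, 5` for `ωᶜ`; the four framed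
supports are pairwise disjoint, so the two open arms are disjoint (confining sets = the supports)
and the four events are independent.

* `sepInitArm_pair_subset_sepOpenDuoQ` — the explicit arm in the frames `0`, `2` is a pair of
  disjoint fenced open arms;
* `pow_le_real_sepFourAdjQ_at` — the estimate.

Everything here is proved; no named facts are introduced.

## References

* P. Nolin, Near-critical percolation in two dimensions, *Electron. J. Probab.* 13 (2008), §4.3
  Prop. 12 (proof) and Prop. 14, §4.4 (arXiv 0711.4948: Prop. 11, Prop. 13, proof of Thm. 10), for
  `σ = BBWW` [Nolin2008].
* W. Werner, *Lectures on two-dimensional critical percolation*, PCMI 16 (2009), Lecture 6, §4 and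
  Lemma 6.3 [WernerPCMI2009].

Tree: `sepInitArm`, `sepInitArmFinset`, `determinedBy_sepInitArm`, `sepInitArm_subset_sepOpenArm`
(`ArmSeparationSepInit.lean`); `le_real_sepInitArm_at`, `sepInitArmFinset_cone`
(`ArmSeparationSepInitFour.lean`); `sepOpenDuoQ`, `sepFourAdjQ`, `frameConfig_inter`
(`ArmSeparationExtFourAdj.lean`); `frameIso_apply_formula`, `frameIso_two_two`,
`frameConfig_two_three`, `real_preimage_frameConfig`, `determinedBy_preimage_frameConfig`,
`DeterminedBy.preimage_compl'`, `sitePercolation_real_inter_of_disjoint`,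
`sitePercolation_real_preimage_compl`.
-/

noncomputable section

open MeasureTheory Set

namespace Literature.Probability.Percolation

open LatticeModels

/-- **The explicit arm in the frames `0` and `2` gives two DISJOINT fenced open arms landing on the
sides `0`, `2`**: the confining sets are the support of the explicit arm and its transposed image,
disjoint because both lie in the open cone of their side (`sepInitArmFinset_cone`). [cite: Nolin2008, §4.3 Prop. 14 (arXiv 0711.4948: Prop. 13), σ = BBWW] -/
theorem sepInitArm_pair_subset_sepOpenDuoQ {m N : ℕ} (hm : 1100 ≤ m) (hmN : 2 * m ≤ N) :
    sepInitArm m N ∩ {ω | frameConfig 2 ω ∈ sepInitArm m N} ⊆ sepOpenDuoQ m N := by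
  rintro ω ⟨h0, h2⟩
  simp only [Set.mem_setOf_eq] at h2
  set F : Set (Site 2) := ↑(sepInitArmFinset m N) with hF
  have dA := determinedBy_sepInitArm m N
  rw [determinedBy_iff] at dA
  refine ⟨F, {v | frameIso 2 v ∈ F}, ?_, ?_, ?_⟩
  · rw [Set.disjoint_left]
    intro v hv hv'
    have c1 := sepInitArmFinset_cone (by omega) hmN (Finset.mem_coe.1 hv)
    have c2 := sepInitArmFinset_cone (by omega) hmN (Finset.mem_coe.1 (show frameIso 2 v ∈ F from hv'))
    obtain ⟨-, -, -, -, f20, f21, -⟩ := frameIso_apply_formula v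
    rw [f20, f21] at c2
    omega
  · refine sepInitArm_subset_sepOpenArm hm hmN ((dA (ω ∩ F) ω ?_).2 h0)
    rw [Set.inter_assoc, Set.inter_self]
  · rw [frameConfig_inter]
    have he : {v : Site 2 | frameIso 2 v ∈ {w : Site 2 | frameIso 2 w ∈ F}} = F := by
      ext v; simp only [Set.mem_setOf_eq, frameIso_two_two]
    rw [he]
    refine sepInitArm_subset_sepOpenArm hm hmN ((dA (frameConfig 2 ω ∩ F) (frameConfig 2 ω) ?_).2 h2)
    rw [Set.inter_assoc, Set.inter_self]

/-- **The initial estimate of the adjacent four-arm scheme at `p`**: with the RSW input `hrsw` at `p`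
and at `1 - p` (aspect ratio `ρ ≥ 1024`, heights `≤ Ncap`), `P_p(sepFourAdjQ m N) ≥ (c⁵)⁴` for
`1100 ≤ m`, `2m ≤ N ≤ 10 m`, `N ≤ Ncap`: the explicit fenced open arm read in the frames `0, 2` for
`ω` and `3, 5` for `ωᶜ` (independent: the framed supports lie in the four pairwise disjoint cones),
each at cost `c⁵` (`le_real_sepInitArm_at` at `p` for the open arms, at `1 - p` for the closed
ones). [cite: Nolin2008, §4.3 Prop. 14, §4.4 (arXiv 0711.4948: Prop. 13; proof of Thm. 10, first scale), σ = BBWW] -/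
theorem pow_le_real_sepFourAdjQ_at (p : unitInterval) {c : ℝ} {ρ Ncap : ℕ}
    (hrsw : ∀ q : unitInterval, (q = p ∨ q = unitInterval.symm p) →
      ∀ k : ℕ, 1 ≤ ⌊(ρ : ℝ) * k⌋₊ → k ≤ Ncap → c ≤ triLRCrossingProb q ⌊(ρ : ℝ) * k⌋₊ k)
    (hρ : 1024 ≤ ρ) (hc : 0 ≤ c) {m N : ℕ} (hm : 1100 ≤ m) (hmN : 2 * m ≤ N) (hN : N ≤ 10 * m) (hcap : N ≤ Ncap) :
    (c ^ 5) ^ 4 ≤ (triSitePercolation p).real (sepFourAdjQ m N) := by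
  classical
  set A := sepInitArm m N with hA
  set F := sepInitArmFinset m N with hF
  have dA : DeterminedBy A ↑F := determinedBy_sepInitArm m N
  have dAf : ∀ i, DeterminedBy {ω : SiteConfig (Site 2) | frameConfig i ω ∈ A} ↑(F.image (frameIso i)) := fun i => by
    rw [Finset.coe_image]; exact determinedBy_preimage_frameConfig i dA
  have dAfc : ∀ i, DeterminedBy {ω : SiteConfig (Site 2) | frameConfig i ωᶜ ∈ A} ↑(F.image (frameIso i)) := fun i => by
    have h2 : {ω : SiteConfig (Site 2) | frameConfig i ωᶜ ∈ A} =
        {ω : SiteConfig (Site 2) | ωᶜ ∈ {χ : SiteConfig (Site 2) | frameConfig i χ ∈ A}} := by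
      ext ω; simp only [Set.mem_setOf_eq]
    rw [h2]; exact DeterminedBy.preimage_compl' (dAf i)
  have cone := fun {v : Site 2} (hv : v ∈ F) => sepInitArmFinset_cone (by omega) hmN hv
  -- pairwise disjointness of the framed supports
  have disj : ∀ i j : ℕ, i ≠ j → (i = 0 ∨ i = 2 ∨ i = 3 ∨ i = 5) → (j = 0 ∨ j = 2 ∨ j = 3 ∨ j = 5) →
      Disjoint (F.image (frameIso i)) (F.image (frameIso j)) := by
    intro i j hij hi hj
    rw [Finset.disjoint_left]
    intro v hv hv'
    rw [Finset.mem_image] at hv hv'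
    obtain ⟨u, hu, rfl⟩ := hv
    obtain ⟨w, hw, huw⟩ := hv'
    have cu := cone hu
    have cw := cone hw
    obtain ⟨u00, u01, -, -, u20, u21, u30, u31, -, -, u50, u51⟩ := frameIso_apply_formula u
    obtain ⟨w00, w01, -, -, w20, w21, w30, w31, -, -, w50, w51⟩ := frameIso_apply_formula w
    have e0 := congrFun huw 0
    have e1 := congrFun huw 1
    rcases hi with rfl | rfl | rfl | rfl <;> rcases hj with rfl | rfl | rfl | rfl <;>
      first
        | exact absurd rfl hij
        | (simp only [u00, u01, u20, u21, u30, u31, u50, u51, w00, w01, w20, w21, w30, w31, w50, w51] at e0 e1; omega)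
  -- the four framed events and their probabilities
  have h5 : ∀ q : unitInterval, (q = p ∨ q = unitInterval.symm p) → c ^ 5 ≤ (triSitePercolation q).real A :=
    fun q hq => le_real_sepInitArm_at q (hrsw q hq) hρ hc hm hmN hN hcap
  have hA0 : {ω : SiteConfig (Site 2) | frameConfig 0 ω ∈ A} = A := by
    ext ω; simp only [Set.mem_setOf_eq]
    have : frameConfig 0 ω = ω := by ext v; rw [mem_frameConfig]; rfl
    rw [this]
  have r2 : (triSitePercolation p).real {ω : SiteConfig (Site 2) | frameConfig 2 ω ∈ A} = (triSitePercolation p).real A :=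
    real_preimage_frameConfig p 2 A
  have rc : ∀ i, (triSitePercolation p).real {ω : SiteConfig (Site 2) | frameConfig i ωᶜ ∈ A} =
      (triSitePercolation (unitInterval.symm p)).real A := fun i => by
    have h2 : {ω : SiteConfig (Site 2) | frameConfig i ωᶜ ∈ A} = compl ⁻¹' {χ : SiteConfig (Site 2) | frameConfig i χ ∈ A} := by
      ext ω; simp only [Set.mem_setOf_eq, Set.mem_preimage]
    rw [h2]
    unfold triSitePercolation
    rw [sitePercolation_real_preimage_compl]
    exact real_preimage_frameConfig (unitInterval.symm p) i A
  -- independence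
  have dA0 : DeterminedBy A ↑(F.image (frameIso 0)) := by have h := dAf 0; rwa [hA0] at h
  have i02 := sitePercolation_real_inter_of_disjoint p dA0 (dAf 2)
    (disj 0 2 (by norm_num) (Or.inl rfl) (Or.inr (Or.inl rfl)))
  have d02 : DeterminedBy (A ∩ {ω : SiteConfig (Site 2) | frameConfig 2 ω ∈ A}) ↑(F.image (frameIso 0) ∪ F.image (frameIso 2)) := by
    rw [Finset.coe_union]
    exact (dA0.mono Set.subset_union_left).inter ((dAf 2).mono Set.subset_union_right)
  have i023 := sitePercolation_real_inter_of_disjoint p d02 (dAfc 3)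
    (Finset.disjoint_union_left.2 ⟨disj 0 3 (by norm_num) (Or.inl rfl) (Or.inr (Or.inr (Or.inl rfl))),
      disj 2 3 (by norm_num) (Or.inr (Or.inl rfl)) (Or.inr (Or.inr (Or.inl rfl)))⟩)
  have d023 : DeterminedBy (A ∩ {ω : SiteConfig (Site 2) | frameConfig 2 ω ∈ A} ∩ {ω | frameConfig 3 ωᶜ ∈ A})
      ↑(F.image (frameIso 0) ∪ F.image (frameIso 2) ∪ F.image (frameIso 3)) := by
    rw [Finset.coe_union]
    exact (d02.mono Set.subset_union_left).inter ((dAfc 3).mono Set.subset_union_right)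
  have i0235 := sitePercolation_real_inter_of_disjoint p d023 (dAfc 5)
    (Finset.disjoint_union_left.2 ⟨Finset.disjoint_union_left.2
      ⟨disj 0 5 (by norm_num) (Or.inl rfl) (Or.inr (Or.inr (Or.inr rfl))), disj 2 5 (by norm_num) (Or.inr (Or.inl rfl)) (Or.inr (Or.inr (Or.inr rfl)))⟩,
      disj 3 5 (by norm_num) (Or.inr (Or.inr (Or.inl rfl))) (Or.inr (Or.inr (Or.inr rfl)))⟩)
  -- the inclusion
  have hsub : A ∩ {ω : SiteConfig (Site 2) | frameConfig 2 ω ∈ A} ∩ {ω | frameConfig 3 ωᶜ ∈ A} ∩ {ω | frameConfig 5 ωᶜ ∈ A} ⊆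
      sepFourAdjQ m N := by
    rintro ω ⟨⟨⟨h0, h2⟩, h3⟩, h5'⟩
    refine ⟨sepInitArm_pair_subset_sepOpenDuoQ hm hmN ⟨h0, h2⟩, ?_⟩
    simp only [Set.mem_setOf_eq] at h3 h5' ⊢
    rw [← frameConfig_two_three] at h5'
    exact sepInitArm_pair_subset_sepOpenDuoQ hm hmN ⟨h3, h5'⟩
  have hp := h5 p (Or.inl rfl)
  have hq := h5 (unitInterval.symm p) (Or.inr rfl)
  have hc5 : 0 ≤ c ^ 5 := pow_nonneg hc 5
  unfold triSitePercolation at r2 rc hp hq i02 i023 i0235 ⊢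
  calc (c ^ 5) ^ 4 = c ^ 5 * c ^ 5 * c ^ 5 * c ^ 5 := by ring
    _ ≤ (sitePercolation (Site 2) p).real A * (sitePercolation (Site 2) p).real {ω : SiteConfig (Site 2) | frameConfig 2 ω ∈ A} *
          (sitePercolation (Site 2) p).real {ω : SiteConfig (Site 2) | frameConfig 3 ωᶜ ∈ A} *
          (sitePercolation (Site 2) p).real {ω : SiteConfig (Site 2) | frameConfig 5 ωᶜ ∈ A} := by
        rw [r2, rc 3, rc 5]
        have h0 : ∀ s, 0 ≤ (sitePercolation (Site 2) p).real s := fun s => measureReal_nonneg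
        have h0' : ∀ s, 0 ≤ (sitePercolation (Site 2) (unitInterval.symm p)).real s := fun s => measureReal_nonneg
        have t2 := mul_le_mul hp hp hc5 (h0 _)
        have t3 := mul_le_mul t2 hq hc5 (mul_nonneg (h0 _) (h0 _))
        exact mul_le_mul t3 hq hc5 (mul_nonneg (mul_nonneg (h0 _) (h0 _)) (h0' _))
    _ = (sitePercolation (Site 2) p).real (A ∩ {ω : SiteConfig (Site 2) | frameConfig 2 ω ∈ A} ∩ {ω | frameConfig 3 ωᶜ ∈ A} ∩
          {ω | frameConfig 5 ωᶜ ∈ A}) := by rw [i0235, i023, i02]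
    _ ≤ (sitePercolation (Site 2) p).real (sepFourAdjQ m N) := measureReal_mono hsub (measure_ne_top _ _)

end Literature.Probability.Percolation
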